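import Summits.NavierStokesRegularity.NavierStokesRegularity.Theorems.EulerZoomLiouvillePowerGaugeEulerLiouvilleWeakPressureGradientTools
import Summits.NavierStokesRegularity.NavierStokesRegularity.Theorems.SwirlHolderTowerFunnelDrift

/-!
# CIV (3.3) IN THE WEAK CLASS, II: the weak pressure-gradient law `∇P = −(1−γ)V − DV·W`
# (crux `EulerZoomLiouville.PowerGaugeEulerLiouville` = stmt-NavierStokesRegularity-19832, line `birth`, open stub `stub_selfSimilarWeakRest`)

Width seat `ns-ezl-w1` (g6) under the crux LEAD, cell ns-regularity-ideate.  TOOL for the genuinely weak exactly-self-similar stratum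
(sequel of `…WeakBernoulliTransport*`: there CIV (3.31) in `𝒟′`, here CIV (3.3) itself in non-divergence form).

The lineage transfers the Euler identity of a weak class member to its profile in DIVERGENCE form
(`ProfileEquation.weak_profile_equation`): for every test field `ψ`,
`∫ ⟪V,(V·∇)ψ⟫ + P div ψ + γ⟪V,(y·∇)ψ⟫ + (4γ−1)⟪V,ψ⟫ = 0`.  Since a class profile has a whole-space weak gradient
`G ∈ L²_loc` (the `E`-gauge) and `V ∈ L⁶_loc`, the two transport terms can be integrated by parts ONCE MORE, which puts the
profile equation in NON-DIVERGENCE form and exhibits the weak gradient of the pressure: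
`∇P = −(1−γ)V − G(W)`, `W = γy + V` — CIV (3.3) POINTWISE A.E., `P ∈ W^{1,1}_loc` (indeed `W^{1,3/2}_loc`), NO regularity assumed.
Chain of three files: `…WeakPressureGradientTools` ((N1), (N2)), `…WeakPressureGradient` ((N3), (N4)), `…WeakPressureGradientMember`.

THIS FILE:
* (N3) `WeakPressure.integral_pressure_mul_divergence` — **`∫ P div ψ = ∫⟪G(W) + (1−γ)V, ψ⟫`** for every test field `ψ`;
* (N4) **`WeakPressure.hasWeakFDerivOn_pressure`** — `HasWeakFDerivOn ⊤ volume P (x ↦ −⟪G x (W x) + (1−γ)V x, ·⟫)`;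
* tools (reusing `SwirlHolderTower.divergence_fun_const`): `locallyIntegrable_of_memLp_threeHalves_ball`, `aestronglyMeasurable_transport`, `locallyIntegrable_gradientField`
  (the field `G(W) + (1−γ)V` is locally integrable).

WHAT THIS IS NOT: not NS, not E, not the stub — a weak-class TOOL (`--supports` stmt-19832); it gives regularity-free access to
`∇P`, hence to `∇ℋ` (Lamb form (3.29)) and to truncations of `P`/`ℋ`, for `stub_selfSimilarWeakRest`.
[folklore; cf. ConstantinIgnatovaVicol2026Putative §3.1.1 (3.3)]
-/

noncomputable section

set_option linter.dupNamespace false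
-- nested operator types (`innerSL … ∘L …`)
set_option maxSynthPendingDepth 3

open MeasureTheory Set Filter Topology Metric Function TopologicalSpace
open scoped ENNReal NNReal RealInnerProductSpace ContDiff

namespace Summit.NavierStokesRegularity.NavierStokesRegularity.Theorems.PowerGaugeEulerLiouville

open Literature.Analysis Literature.Analysis.FunctionSpaces Literature.Analysis.FluidPDE

namespace WeakPressure

variable {V : EuclideanSpace ℝ (Fin 3) → EuclideanSpace ℝ (Fin 3)} {P : EuclideanSpace ℝ (Fin 3) → ℝ}
  {G : EuclideanSpace ℝ (Fin 3) → EuclideanSpace ℝ (Fin 3) →L[ℝ] EuclideanSpace ℝ (Fin 3)}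

/-! ## (N3) the pressure against divergences, (N4) the weak gradient of the pressure -/

/-- `P ∈ L^{3/2}(B_r)` for every `r` makes `P` locally integrable. [folklore] -/
theorem locallyIntegrable_of_memLp_threeHalves_ball
    (hP : ∀ r : ℝ, MemLp P (3 / 2 : ℝ≥0∞) (volume.restrict (ball (0 : EuclideanSpace ℝ (Fin 3)) r))) :
    LocallyIntegrable P volume := by
  intro x
  refine ⟨ball 0 (‖x‖ + 1), isOpen_ball.mem_nhds (by rw [mem_ball, dist_zero_right]; linarith), ?_⟩
  haveI : IsFiniteMeasure ((volume : Measure (EuclideanSpace ℝ (Fin 3))).restrict (ball 0 (‖x‖ + 1))) :=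
    isFiniteMeasure_restrict.2 measure_ball_lt_top.ne
  exact memLp_one_iff_integrable.1 ((hP (‖x‖ + 1)).mono_exponent
    (by rw [ENNReal.le_div_iff_mul_le (Or.inl (by norm_num)) (Or.inl (by norm_num))]; norm_num))

/-- The similarity field `W = γy + V` is a.e.-strongly measurable when `V` is. [folklore] -/
theorem aestronglyMeasurable_transport {γ : ℝ} (hVm : AEStronglyMeasurable V volume) :
    AEStronglyMeasurable (selfSimilarTransport γ 0 V) volume := by
  have e : selfSimilarTransport γ 0 V = (fun x : EuclideanSpace ℝ (Fin 3) => γ • (x - 0)) + V := by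
    funext x; rfl
  rw [e]
  have h1 : Continuous (fun x : EuclideanSpace ℝ (Fin 3) => γ • (x - 0)) := by fun_prop
  exact h1.aestronglyMeasurable.add hVm

/-- The field `x ↦ G(x)(W x) + (1−γ)V(x)` (`W = γy + V`) is locally integrable for `V, G ∈ L²_loc`. [folklore] -/
theorem locallyIntegrable_gradientField {γ : ℝ} (hVm : AEStronglyMeasurable V volume)
    (hV6 : ∀ r : ℝ, MemLp V 6 (volume.restrict (ball (0 : EuclideanSpace ℝ (Fin 3)) r)))
    (hVG : HasWeakFDerivOn (⊤ : Opens (EuclideanSpace ℝ (Fin 3))) volume V G)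
    (hG2 : ∀ r : ℝ, MemLp G 2 (volume.restrict (ball (0 : EuclideanSpace ℝ (Fin 3)) r))) :
    LocallyIntegrable (fun x => G x (selfSimilarTransport γ 0 V x) + (1 - γ) • V x) volume := by
  have hGl : LocallyIntegrable G volume := locallyIntegrableOn_univ.1 (by
    simpa only [Opens.coe_top] using hVG.locallyIntegrableOn_deriv)
  have hGm : AEStronglyMeasurable G volume := hGl.aestronglyMeasurable
  have hVl : LocallyIntegrable V volume := WeakBernoulli.locallyIntegrable_of_memLp_six_ball hV6
  have hGWm : AEStronglyMeasurable (fun x => G x (selfSimilarTransport γ 0 V x)) volume :=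
    ProfileEnergy.aestronglyMeasurable_clm_apply hGm (aestronglyMeasurable_transport hVm)
  intro x
  refine ⟨ball 0 (‖x‖ + 1), isOpen_ball.mem_nhds (by rw [mem_ball, dist_zero_right]; linarith), ?_⟩
  haveI : IsFiniteMeasure ((volume : Measure (EuclideanSpace ℝ (Fin 3))).restrict (ball 0 (‖x‖ + 1))) :=
    isFiniteMeasure_restrict.2 measure_ball_lt_top.ne
  have hV2 : MemLp V 2 (volume.restrict (ball (0 : EuclideanSpace ℝ (Fin 3)) (‖x‖ + 1))) :=
    (hV6 (‖x‖ + 1)).mono_exponent (by norm_num)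
  have hGV : IntegrableOn (fun y => ‖G y‖ * ‖V y‖) (ball (0 : EuclideanSpace ℝ (Fin 3)) (‖x‖ + 1)) volume :=
    integrableOn_norm_mul_norm (hG2 (‖x‖ + 1)) hV2
  have hG1 : IntegrableOn (fun y => ‖G y‖) (ball (0 : EuclideanSpace ℝ (Fin 3)) (‖x‖ + 1)) volume :=
    ((hGl.integrableOn_isCompact (isCompact_closedBall 0 (‖x‖ + 1))).mono_set ball_subset_closedBall).norm
  have hV1 : IntegrableOn V (ball (0 : EuclideanSpace ℝ (Fin 3)) (‖x‖ + 1)) volume :=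
    (hVl.integrableOn_isCompact (isCompact_closedBall 0 (‖x‖ + 1))).mono_set ball_subset_closedBall
  have hdom : IntegrableOn (fun y => |γ| * (‖x‖ + 1) * ‖G y‖ + ‖G y‖ * ‖V y‖)
      (ball (0 : EuclideanSpace ℝ (Fin 3)) (‖x‖ + 1)) volume := (hG1.const_mul _).add hGV
  have hGW : IntegrableOn (fun y => G y (selfSimilarTransport γ 0 V y)) (ball (0 : EuclideanSpace ℝ (Fin 3)) (‖x‖ + 1))
      volume := by
    refine Integrable.mono' hdom hGWm.restrict ?_
    filter_upwards [ae_restrict_mem measurableSet_ball] with y hy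
    rw [mem_ball, dist_zero_right] at hy
    calc ‖G y (selfSimilarTransport γ 0 V y)‖ ≤ ‖G y‖ * ‖selfSimilarTransport γ 0 V y‖ := (G y).le_opNorm _
      _ ≤ ‖G y‖ * (|γ| * (‖x‖ + 1) + ‖V y‖) := by
          refine mul_le_mul_of_nonneg_left ?_ (norm_nonneg _)
          rw [WeakBernoulli.transport_zero_apply]
          calc ‖γ • y + V y‖ ≤ ‖γ • y‖ + ‖V y‖ := norm_add_le _ _
            _ ≤ |γ| * (‖x‖ + 1) + ‖V y‖ := by
                rw [norm_smul, Real.norm_eq_abs]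
                exact add_le_add (mul_le_mul_of_nonneg_left hy.le (abs_nonneg _)) le_rfl
      _ = |γ| * (‖x‖ + 1) * ‖G y‖ + ‖G y‖ * ‖V y‖ := by ring
  exact hGW.add (hV1.smul (1 - γ))

/-- **(N3) `∫ P div ψ = ∫ ⟪G(W) + (1−γ)V, ψ⟫`** for every test field `ψ` (`W = γy + V`): the weak profile equation of a
class profile (`V ∈ L⁶_loc`, whole-space weak gradient `G ∈ L²_loc`, weakly divergence free, `P ∈ L^{3/2}_loc`) with its two
transport terms integrated by parts once more ((N1), (N2)). [folklore; cf. ConstantinIgnatovaVicol2026Putative §3.1.1 (3.3)] -/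
theorem integral_pressure_mul_divergence {γ : ℝ} (hVm : AEStronglyMeasurable V volume) (hPm : AEStronglyMeasurable P volume)
    (hV6 : ∀ r : ℝ, MemLp V 6 (volume.restrict (ball (0 : EuclideanSpace ℝ (Fin 3)) r)))
    (hVG : HasWeakFDerivOn (⊤ : Opens (EuclideanSpace ℝ (Fin 3))) volume V G)
    (hG2 : ∀ r : ℝ, MemLp G 2 (volume.restrict (ball (0 : EuclideanSpace ℝ (Fin 3)) r)))
    (hP : ∀ r : ℝ, MemLp P (3 / 2 : ℝ≥0∞) (volume.restrict (ball (0 : EuclideanSpace ℝ (Fin 3)) r)))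
    (hdiv : IsWeaklyDivFree V)
    (heq : ∀ ψ : EuclideanSpace ℝ (Fin 3) → EuclideanSpace ℝ (Fin 3),
      IsTestFunctionOn (⊤ : Opens (EuclideanSpace ℝ (Fin 3))) ψ →
        ∫ x, (⟪V x, fderiv ℝ ψ x (V x)⟫ + P x * VectorCalculus.divergence ψ x +
          γ * ⟪V x, fderiv ℝ ψ x x⟫ + (4 * γ - 1) * ⟪V x, ψ x⟫) = 0)
    {ψ : EuclideanSpace ℝ (Fin 3) → EuclideanSpace ℝ (Fin 3)} (hψ : IsTestFunctionOn (⊤ : Opens (EuclideanSpace ℝ (Fin 3))) ψ) :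
    ∫ x, P x * VectorCalculus.divergence ψ x =
      ∫ x, ⟪G x (selfSimilarTransport γ 0 V x) + (1 - γ) • V x, ψ x⟫ := by
  -- ### supports, bounds, local integrability
  have hVl : LocallyIntegrable V volume := WeakBernoulli.locallyIntegrable_of_memLp_six_ball hV6
  have hGl : LocallyIntegrable G volume := locallyIntegrableOn_univ.1 (by
    simpa only [Opens.coe_top] using hVG.locallyIntegrableOn_deriv)
  have hGm : AEStronglyMeasurable G volume := hGl.aestronglyMeasurable
  have hPl : LocallyIntegrable P volume := locallyIntegrable_of_memLp_threeHalves_ball hP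
  have hψd : Differentiable ℝ ψ := hψ.contDiff.differentiable (by simp)
  have hψc : Continuous ψ := hψ.contDiff.continuous
  have hDψc : Continuous (fderiv ℝ ψ) := hψ.contDiff.continuous_fderiv (by simp)
  have hdivc : Continuous (VectorCalculus.divergence ψ) := continuous_divergence hDψc
  set K : Set (EuclideanSpace ℝ (Fin 3)) := tsupport ψ with hKdef
  have hKc : IsCompact K := hψ.hasCompactSupport
  have hKm : MeasurableSet K := (isClosed_tsupport ψ).measurableSet
  obtain ⟨R₀, hR₀⟩ := hKc.isBounded.subset_ball (0 : EuclideanSpace ℝ (Fin 3))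
  set R : ℝ := max R₀ 1 with hRdef
  have hR0 : 0 ≤ R := le_trans zero_le_one (le_max_right _ _)
  have hKB : K ⊆ ball (0 : EuclideanSpace ℝ (Fin 3)) R := hR₀.trans (ball_subset_ball (le_max_left _ _))
  have hxK : ∀ x ∈ K, ‖x‖ ≤ R := fun x hx => by
    have := hKB hx; rw [mem_ball, dist_zero_right] at this; exact this.le
  have hψK : ∀ x, x ∉ K → ψ x = 0 := fun x hx => image_eq_zero_of_notMem_tsupport hx
  have hDψK : ∀ x, x ∉ K → fderiv ℝ ψ x = 0 := fun x hx => fderiv_of_notMem_tsupport ℝ hx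
  have hdivK : ∀ x, x ∉ K → VectorCalculus.divergence ψ x = 0 := fun x hx => divergence_eq_zero_of_notMem_tsupport hx
  obtain ⟨C₀, hC₀⟩ := hψc.bounded_above_of_compact_support hψ.hasCompactSupport
  obtain ⟨C₁, hC₁⟩ := hDψc.bounded_above_of_compact_support (hψ.hasCompactSupport.fderiv (𝕜 := ℝ))
  obtain ⟨C₂, hC₂⟩ := hdivc.bounded_above_of_compact_support (HasCompactSupport.intro hKc fun x hx => hdivK x hx)
  have hC₀0 : 0 ≤ C₀ := (norm_nonneg _).trans (hC₀ 0)
  have hC₁0 : 0 ≤ C₁ := (norm_nonneg _).trans (hC₁ 0)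
  haveI hBfin : IsFiniteMeasure ((volume : Measure (EuclideanSpace ℝ (Fin 3))).restrict (ball (0 : EuclideanSpace ℝ (Fin 3)) R)) :=
    isFiniteMeasure_restrict.2 measure_ball_lt_top.ne
  have hV2B : MemLp V 2 (volume.restrict (ball (0 : EuclideanSpace ℝ (Fin 3)) R)) := (hV6 R).mono_exponent (by norm_num)
  have hV2K : IntegrableOn (fun x => ‖V x‖ ^ 2) K volume :=
    IntegrableOn.mono_set (hV2B.integrable_norm_pow (by norm_num)) hKB
  have hV1K : IntegrableOn (fun x => ‖V x‖) K volume := (hVl.integrableOn_isCompact hKc).norm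
  have hG1K : IntegrableOn (fun x => ‖G x‖) K volume := (hGl.integrableOn_isCompact hKc).norm
  have hP1K : IntegrableOn (fun x => |P x|) K volume := (hPl.integrableOn_isCompact hKc).abs
  have hGVK : IntegrableOn (fun x => ‖G x‖ * ‖V x‖) K volume := (integrableOn_norm_mul_norm (hG2 R) hV2B).mono_set hKB
  -- ### the integrable pieces
  have hIA : Integrable (fun x => ⟪V x, fderiv ℝ ψ x (V x)⟫) volume := by
    refine ProfileEnergy.integrable_of_abs_le_on hKm (hVm.inner (ProfileEnergy.aestronglyMeasurable_clm_apply
      hDψc.aestronglyMeasurable hVm)) hV2K (C := C₁) (fun x _ => ?_) (fun x hx => by simp [hDψK x hx])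
    rw [abs_of_nonneg (by positivity : (0 : ℝ) ≤ ‖V x‖ ^ 2)]
    calc |⟪V x, fderiv ℝ ψ x (V x)⟫| ≤ ‖V x‖ * ‖fderiv ℝ ψ x (V x)‖ := abs_real_inner_le_norm _ _
      _ ≤ ‖V x‖ * (C₁ * ‖V x‖) := mul_le_mul_of_nonneg_left
          (((fderiv ℝ ψ x).le_opNorm _).trans (mul_le_mul_of_nonneg_right (hC₁ x) (norm_nonneg _))) (norm_nonneg _)
      _ = C₁ * ‖V x‖ ^ 2 := by ring
  have hIB : Integrable (fun x => P x * VectorCalculus.divergence ψ x) volume := by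
    refine ProfileEnergy.integrable_of_abs_le_on hKm (hPm.mul hdivc.aestronglyMeasurable) hP1K (C := C₂)
      (fun x _ => ?_) (fun x hx => by simp [hdivK x hx])
    rw [abs_mul, abs_abs, mul_comm C₂]
    exact mul_le_mul_of_nonneg_left ((Real.norm_eq_abs _).symm.le.trans (hC₂ x)) (abs_nonneg _)
  have hIC : Integrable (fun x => ⟪V x, fderiv ℝ ψ x x⟫) volume := by
    refine ProfileEnergy.integrable_of_abs_le_on hKm (hVm.inner (hDψc.clm_apply continuous_id).aestronglyMeasurable)
      hV1K (C := C₁ * R) (fun x hx => ?_) (fun x hx => by simp [hDψK x hx])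
    rw [abs_norm]
    calc |⟪V x, fderiv ℝ ψ x x⟫| ≤ ‖V x‖ * ‖fderiv ℝ ψ x x‖ := abs_real_inner_le_norm _ _
      _ ≤ ‖V x‖ * (C₁ * R) := mul_le_mul_of_nonneg_left
          (((fderiv ℝ ψ x).le_opNorm _).trans (mul_le_mul (hC₁ x) (hxK x hx) (norm_nonneg _) hC₁0)) (norm_nonneg _)
      _ = C₁ * R * ‖V x‖ := by ring
  have hID : Integrable (fun x => ⟪V x, ψ x⟫) volume :=
    integrable_inner_of_locallyIntegrable_of_hasCompactSupport hVl hψc hψ.hasCompactSupport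
  have hIGx : Integrable (fun x => ⟪G x x, ψ x⟫) volume := by
    refine ProfileEnergy.integrable_of_abs_le_on hKm ((ProfileEnergy.aestronglyMeasurable_clm_apply hGm
      continuous_id.aestronglyMeasurable).inner hψc.aestronglyMeasurable) hG1K (C := R * C₀)
      (fun x hx => ?_) (fun x hx => by simp [hψK x hx])
    rw [abs_norm]
    calc |⟪G x x, ψ x⟫| ≤ ‖G x x‖ * ‖ψ x‖ := abs_real_inner_le_norm _ _
      _ ≤ (‖G x‖ * R) * C₀ := mul_le_mul (((G x).le_opNorm _).trans (mul_le_mul_of_nonneg_left (hxK x hx) (norm_nonneg _)))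
          (hC₀ x) (norm_nonneg _) (by positivity)
      _ = R * C₀ * ‖G x‖ := by ring
  have hIGV : Integrable (fun x => ⟪G x (V x), ψ x⟫) volume := by
    refine ProfileEnergy.integrable_of_abs_le_on hKm ((ProfileEnergy.aestronglyMeasurable_clm_apply hGm hVm).inner
      hψc.aestronglyMeasurable) hGVK (C := C₀) (fun x _ => ?_) (fun x hx => by simp [hψK x hx])
    rw [abs_of_nonneg (by positivity : (0 : ℝ) ≤ ‖G x‖ * ‖V x‖)]
    calc |⟪G x (V x), ψ x⟫| ≤ ‖G x (V x)‖ * ‖ψ x‖ := abs_real_inner_le_norm _ _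
      _ ≤ (‖G x‖ * ‖V x‖) * C₀ := mul_le_mul ((G x).le_opNorm _) (hC₀ x) (norm_nonneg _) (by positivity)
      _ = C₀ * (‖G x‖ * ‖V x‖) := by ring
  -- ### the weak profile equation, split
  have h0 : (∫ x, ⟪V x, fderiv ℝ ψ x (V x)⟫) + (∫ x, P x * VectorCalculus.divergence ψ x) +
      γ * (∫ x, ⟪V x, fderiv ℝ ψ x x⟫) + (4 * γ - 1) * ∫ x, ⟪V x, ψ x⟫ = 0 := by
    have h := heq ψ hψ
    have e1 : ∫ x, (⟪V x, fderiv ℝ ψ x (V x)⟫ + P x * VectorCalculus.divergence ψ x +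
        γ * ⟪V x, fderiv ℝ ψ x x⟫ + (4 * γ - 1) * ⟪V x, ψ x⟫) =
        (∫ x, (⟪V x, fderiv ℝ ψ x (V x)⟫ + P x * VectorCalculus.divergence ψ x + γ * ⟪V x, fderiv ℝ ψ x x⟫)) +
          ∫ x, (4 * γ - 1) * ⟪V x, ψ x⟫ := integral_add ((hIA.add hIB).add (hIC.const_mul γ)) (hID.const_mul _)
    have e2 : ∫ x, (⟪V x, fderiv ℝ ψ x (V x)⟫ + P x * VectorCalculus.divergence ψ x + γ * ⟪V x, fderiv ℝ ψ x x⟫) =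
        (∫ x, (⟪V x, fderiv ℝ ψ x (V x)⟫ + P x * VectorCalculus.divergence ψ x)) + ∫ x, γ * ⟪V x, fderiv ℝ ψ x x⟫ :=
      integral_add (hIA.add hIB) (hIC.const_mul γ)
    have e3 : ∫ x, (⟪V x, fderiv ℝ ψ x (V x)⟫ + P x * VectorCalculus.divergence ψ x) =
        (∫ x, ⟪V x, fderiv ℝ ψ x (V x)⟫) + ∫ x, P x * VectorCalculus.divergence ψ x := integral_add hIA hIB
    have e4 : ∫ x, γ * ⟪V x, fderiv ℝ ψ x x⟫ = γ * ∫ x, ⟪V x, fderiv ℝ ψ x x⟫ := integral_const_mul _ _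
    have e5 : ∫ x, (4 * γ - 1) * ⟪V x, ψ x⟫ = (4 * γ - 1) * ∫ x, ⟪V x, ψ x⟫ := integral_const_mul _ _
    rw [e1, e2, e3, e4, e5] at h
    exact h
  have hN1 := integral_inner_fderiv_apply_self hVm hV6 hVG hG2 hdiv hψ
  have hN2 := integral_inner_fderiv_apply_id hVG hψ
  -- ### the right-hand side, split
  have hrhs : ∫ x, ⟪G x (selfSimilarTransport γ 0 V x) + (1 - γ) • V x, ψ x⟫ =
      γ * (∫ x, ⟪G x x, ψ x⟫) + (∫ x, ⟪G x (V x), ψ x⟫) + (1 - γ) * ∫ x, ⟪V x, ψ x⟫ := by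
    have e : ∀ x, ⟪G x (selfSimilarTransport γ 0 V x) + (1 - γ) • V x, ψ x⟫ =
        γ * ⟪G x x, ψ x⟫ + ⟪G x (V x), ψ x⟫ + (1 - γ) * ⟪V x, ψ x⟫ := fun x => by
      rw [WeakBernoulli.transport_zero_apply, map_add, map_smul, inner_add_left, inner_add_left,
        real_inner_smul_left, real_inner_smul_left]
    rw [integral_congr_ae (Eventually.of_forall e)]
    have e1 : ∫ x, (γ * ⟪G x x, ψ x⟫ + ⟪G x (V x), ψ x⟫ + (1 - γ) * ⟪V x, ψ x⟫) =
        (∫ x, (γ * ⟪G x x, ψ x⟫ + ⟪G x (V x), ψ x⟫)) + ∫ x, (1 - γ) * ⟪V x, ψ x⟫ :=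
      integral_add ((hIGx.const_mul γ).add hIGV) (hID.const_mul _)
    have e2 : ∫ x, (γ * ⟪G x x, ψ x⟫ + ⟪G x (V x), ψ x⟫) = (∫ x, γ * ⟪G x x, ψ x⟫) + ∫ x, ⟪G x (V x), ψ x⟫ :=
      integral_add (hIGx.const_mul γ) hIGV
    rw [e1, e2, integral_const_mul, integral_const_mul]
  rw [hrhs]
  linear_combination h0 - hN1 - γ * hN2

/-- **(N4) THE WEAK PRESSURE-GRADIENT LAW (CIV (3.3) in the weak class).**  For a class profile — `V ∈ L⁶_loc` with whole-space weak
gradient `G ∈ L²_loc`, weakly divergence free, `P ∈ L^{3/2}_loc`, satisfying the weak self-similar Euler profile equation with exponent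
`γ` — the pressure is weakly differentiable on `ℝ³` with
`∇P = −(1−γ)V − G(W)`,  `W = γy + V`,
i.e. `HasWeakFDerivOn ⊤ volume P (x ↦ −⟪G x (W x) + (1−γ)V x, ·⟫)`: the profile equation `(1−γ)V + DV·W + ∇P = 0` of
Constantin–Ignatova–Vicol holds POINTWISE A.E., and `P ∈ W^{1,1}_loc(ℝ³)`, with NO regularity assumed on the profile.
[folklore; cf. ConstantinIgnatovaVicol2026Putative §3.1.1 (3.3)] -/
theorem hasWeakFDerivOn_pressure {γ : ℝ} (hVm : AEStronglyMeasurable V volume) (hPm : AEStronglyMeasurable P volume)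
    (hV6 : ∀ r : ℝ, MemLp V 6 (volume.restrict (ball (0 : EuclideanSpace ℝ (Fin 3)) r)))
    (hVG : HasWeakFDerivOn (⊤ : Opens (EuclideanSpace ℝ (Fin 3))) volume V G)
    (hG2 : ∀ r : ℝ, MemLp G 2 (volume.restrict (ball (0 : EuclideanSpace ℝ (Fin 3)) r)))
    (hP : ∀ r : ℝ, MemLp P (3 / 2 : ℝ≥0∞) (volume.restrict (ball (0 : EuclideanSpace ℝ (Fin 3)) r)))
    (hdiv : IsWeaklyDivFree V)
    (heq : ∀ ψ : EuclideanSpace ℝ (Fin 3) → EuclideanSpace ℝ (Fin 3),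
      IsTestFunctionOn (⊤ : Opens (EuclideanSpace ℝ (Fin 3))) ψ →
        ∫ x, (⟪V x, fderiv ℝ ψ x (V x)⟫ + P x * VectorCalculus.divergence ψ x +
          γ * ⟪V x, fderiv ℝ ψ x x⟫ + (4 * γ - 1) * ⟪V x, ψ x⟫) = 0) :
    HasWeakFDerivOn (⊤ : Opens (EuclideanSpace ℝ (Fin 3))) volume P
      (fun x => -(innerSL ℝ (G x (selfSimilarTransport γ 0 V x) + (1 - γ) • V x))) := by
  have hPl : LocallyIntegrable P volume := locallyIntegrable_of_memLp_threeHalves_ball hP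
  have hgl := locallyIntegrable_gradientField (γ := γ) hVm hV6 hVG hG2
  refine ⟨by simpa only [Opens.coe_top] using hPl.locallyIntegrableOn univ, ?_, fun φ v hφ => ?_⟩
  · have h : LocallyIntegrable (fun x => -(innerSL ℝ (G x (selfSimilarTransport γ 0 V x) + (1 - γ) • V x))) volume := by
      intro x
      obtain ⟨U, hU, hint⟩ := hgl x
      refine ⟨U, hU, ?_⟩
      have hm : AEStronglyMeasurable (fun x => -(innerSL ℝ (G x (selfSimilarTransport γ 0 V x) + (1 - γ) • V x)))
          (volume.restrict U) :=
        ((innerSL ℝ (E := EuclideanSpace ℝ (Fin 3))).continuous.comp_aestronglyMeasurable hint.aestronglyMeasurable).neg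
      exact Integrable.mono' hint.norm hm (Eventually.of_forall fun x => by rw [norm_neg, innerSL_apply_norm])
    simpa only [Opens.coe_top] using h.locallyIntegrableOn univ
  · simp only [Opens.coe_top, Measure.restrict_univ, smul_eq_mul, _root_.neg_apply, innerSL_apply_apply,
      mul_neg, integral_neg, neg_neg]
    have hψ : IsTestFunctionOn (⊤ : Opens (EuclideanSpace ℝ (Fin 3))) (fun x => φ x • v) :=
      ProfileEnergy.isTestFunctionOn_smul hφ contDiff_const
    have h := integral_pressure_mul_divergence (γ := γ) hVm hPm hV6 hVG hG2 hP hdiv heq hψ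
    have hφd : Differentiable ℝ φ := hφ.contDiff.differentiable (by simp)
    have ediv : ∀ x, VectorCalculus.divergence (fun x => φ x • v) x = fderiv ℝ φ x v := fun x => by
      rw [divergence_smul_apply (hφd x) (differentiableAt_const v), SwirlHolderTower.divergence_fun_const, mul_zero, zero_add,
        inner_gradient_eq_fderiv_apply]
    have einner : ∀ x, ⟪G x (selfSimilarTransport γ 0 V x) + (1 - γ) • V x, φ x • v⟫ =
        φ x * ⟪G x (selfSimilarTransport γ 0 V x) + (1 - γ) • V x, v⟫ := fun x => by
      rw [real_inner_smul_right]
    simp_rw [ediv, einner] at h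
    rw [← h]
    exact integral_congr_ae (Eventually.of_forall fun x => by ring)

end WeakPressure

end Summit.NavierStokesRegularity.NavierStokesRegularity.Theorems.PowerGaugeEulerLiouville
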